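import Summits.QuantumFields.YangMills.Theorems.BalabanUVNodesN12WindowGaugeLetterLocal
import Literature.MathematicalPhysics.QuantumFieldTheory.Balaban1983to89.B15Prop1WindowDirectPackageFromLetters
import HarnessLib

/-!
# BalabanUVNodes ∕ N12 — THE WINDOW-LOCAL (σ)_W PRODUCER IN THE SOCKET's SHAPE: `B15Prop1WindowDirectPackageFromLetters.hWD_of_windowLetters_on`'s binder `hσW` (p658881 :108–122), per instance and
# in family form, from `N12WindowGaugeLetterLocal.exists_windowGauge_of_plaqSmall` — general `Z`, no letter off the window

Cell `pub-ymgap` (HUMAN RULINGS D-0062 ∕ D-0149), WIDTH SEAT `pub-ymgap-dag-n12-w6` g7 (node N12 = [B15]; key K1⁹ `stmt-QuantumFields-27364`, `--kind proof --supports … --as helper`;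
count-neutral).  THEOREMS ONLY (0 `def`, 0 `instance`, 0 `sorry`); one `obtain` each on the window gauge of `…N12WindowGaugeLetterLocal` (this seat).

WHAT.  The (WD) package producer of the direct road (dag-n12-c g20, p658881) displays, per instance `i` and per guarded base field `V_k` with `ρn i`-normalised extended datum on the region box
`[LO i, HI i]`, the window gauge letter (σ)_W: for every (2.12) minimiser `U₀`, a residual gauge `σ` (root letter `hu`) with `σ • U₀` bond-wise `δc i`-near `1` on the four bonds of every plaquette
of the window `W i` (C1_window) and `δW i`-near `1` on the feeds of the four bonds of every `(e₀, e_ν′)`-plaquette of the window box `box (n_i+3) (lo_i−2)` (FEEDS).  Until now it was inhabited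
only by restriction of the road of record's (σ)_N (`B15Prop1WindowGaugeLetterOfGaugeLetterLoc.hσW_of_gaugeLetterN_on`, p661555; scope: simply-connected normalisable `Ω₁(Z_i)`).  THIS FILE
inhabits it from LOCAL data: ★★★ `hσW_local_of_plaqSmall` (per instance; any `δc, δW` dominating the window tolerance
`((2ℓ_k+1+m′L^k)²∕4)·(ε·η₀²) + m′·(6·(((d+2)L)²∕4)·(2εL²))·Σ_{i<k}Lⁱ + m′·ρn`) and ★★★ `hσW_on_of_plaqSmall` (the family form, binder-for-binder the socket's `hσW`, with datum `W := ext i V_k`,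
region `𝒞 := boxBonds (LO i) (HI i)`, `hD := hnV`) and ★★★ `hσW_on_of_class` (the same with `hU` read off the minimiser's own class, `ε i := εreg`).  DISPLAYED per instance: numerics (level guard `k+c ≤ m+K` with `4d+m′+3 < 2L^c`; `M₁ ≥ (4d+m′)L²+2dL+12`, `M₁ ≥ ((d+4)L+6)L²`; `ε` ×4;
`hdiv`), the graded plaquette bound `hU` at every minimiser of every guarded datum ([15] Thm 1 (8) ∕ the class — the road's P1 currency), the window `X i` (any set of fine sites) with the REGION-BOX ROW
`hBox` (the `k`-shadows within walk-distance `ℓ_k + m′L^k + L^k` of `X i` are bonds of `[LO i, HI i]`) and the two WINDOW ROWS `hWX` (corners of `W i`'s plaquettes in `X i`), `hfeedsX` (the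
window box's feeds have both ends in `X i`) — pure lattice geometry of the instance.  NO letter off the window; NO condition on the shape of `Ω₁(Z_i)`.

HONEST FRAMING.  ∃∕∀ bookkeeping by name; the minimiser ([15] Thm 1 ∕ (E)), `hU`, the region datum, the window rows and the numerics stay HYPOTHESES; per-instance tolerances; nothing of
Bałaban's asserted; count-neutral; N12 NOT discharged; K1⁹ NOT closed; counts unmoved (typed 28∕28 · discharged 5∕27); one finite 𝕋⁴ programme at fixed `ε = L^{-K}` — R4 closes the
conditional rung `BalabanLadder.UV` only; no summit statement is proved here and NOT the Yang–Mills mass gap (Clay); nothing continuum ∕ ℝ⁴ ∕ OS.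

References: [Balaban1989LargeFieldII] CMP 122 (1989) 355–392, p.357; [Balaban1985Variational] CMP 102 (1985) 277–309, (4) p.278, Thm 1 (8) p.279, (16)–(18) p.280; [Balaban1988Convergent]
CMP 119 (1988) 243–285, (2.2) p.255, (2.11)–(2.13) pp.256–257, (2.16) p.257.
-/

noncomputable section

open scoped Matrix.Norms.L2Operator BigOperators

namespace Summit.QuantumFields.YangMills.BalabanUVNodes.N12WindowGaugeLetterLocalSocket

open Literature.MathematicalPhysics.QuantumFieldTheory.Balaban1983to89
open T4Continuum GaugeField B15DeterminingSets BlockAveraging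
open T4CubeChartGnomonic (SU2)
open B16Sect1Backgrounds (toMS)
open T4AxialGaugeSmallField (boxBonds castSite)
open B16Eq18Proof (box)
open B14.Eq213MaximalDomains (side)
open B14.Eq213DetSet (Bj maxDomT)
open B14.Eq216Concrete (feeds)
open B14.Eq22Determines (blockIter)
open B8Eq17ClassAkV1 (plaqsOf)
open B15Prop1Carrier (plaqsInside)
open ExpMeanLog (deltaSU)
open Literature.MathematicalPhysics.QuantumFieldTheory.BalabanImbrieJaffe1984to88.BIJ85Eq453GaugeField (qsstarGIter0)
open Summit.QuantumFields.YangMills.BalabanUVNodes.N12WindowGaugeLetterLocal (exists_windowGauge_of_plaqSmall)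

/-! ## The window gauge letter (σ)_W of the direct road: per instance, and the family form of `hWD_of_windowLetters_on`'s binder `hσW` -/

/-- ★★★ **THE WINDOW GAUGE LETTER (σ)_W OF THE DIRECT ROAD, PER INSTANCE, FROM LOCAL DATA.**  `exists_windowGauge_of_plaqSmall` read in the shape of the (WD) package's letter (dag-n12-c's
`B15Prop1WindowDirectPackageFromLetters.hWD_of_windowLetters_on`, binder `hσW`; dag-n12-w4's C1_window ∕ FEEDS texts): a residual gauge `σ` of the minimiser with the ROOT LETTER `hu`, `σ • U₀`
bond-wise `δc`-near `1` on the four bonds of every plaquette of the window `Wp`, and `δW`-near `1` on the feeds of the four bonds of every `(e₀, e_ν′)`-plaquette of the window box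
`box (n+3) (lo−2)` (level `k`) — for ANY `δc, δW` dominating the window tolerance of `exists_windowGauge_of_plaqSmall`, under two WINDOW ROWS (pure lattice geometry of the instance): `hWX` (the corners of `Wp`'s plaquettes lie in `X`)
and `hfeedsX` (those feeds have both ends in `X`).  No letter off the window; no condition on the shape of `Ω₁(Z)`.
[cite: Balaban1989LargeFieldII, p.357; Balaban1985Variational, (4) p.278, (16)–(18) p.280; Balaban1988Convergent, (2.2) p.255, (2.11)–(2.12) p.256, (2.16) p.257] -/
theorem hσW_local_of_plaqSmall {F : T4Family} (ν : Node00.Stage7Numerics) (Kt : ℕ) (h0 : 0 < (F.P Kt).d) {k : ℕ} (hk0 : 0 < k) (hk : k ≤ (F.P Kt).m + (F.P Kt).K)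
    (hdiv : side (F.P Kt).L ν.M₁ k ∣ (F.P Kt).sitesPerDir 0) (Z : Set (Site (F.P Kt) 0))
    {c : ℕ} (hkc : k + c ≤ (F.P Kt).m + (F.P Kt).K) (hc : 4 * (F.P Kt).d + (3 * ((F.P Kt).d * (((F.P Kt).L - 1) / 2)) + 5) + 3 < 2 * (F.P Kt).L ^ c)
    (hMrad : (4 * (F.P Kt).d + (3 * ((F.P Kt).d * (((F.P Kt).L - 1) / 2)) + 5)) * (F.P Kt).L ^ 2 + 2 * (F.P Kt).d * (F.P Kt).L + 12 ≤ ν.M₁)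
    (hM₁ : (((F.P Kt).d + 4) * (F.P Kt).L + 6) * (F.P Kt).L ^ 2 ≤ ν.M₁)
    {ρn : ℝ} (hρn : 0 ≤ ρn)
    (W : GaugeField (F.P Kt) k SU2) (𝒞 : Set (PBond (F.P Kt) k)) (hD : ∀ c ∈ 𝒞, dist1 (W c) ≤ ρn)
    {U₀ : GaugeField (F.P Kt) 0 SU2}
    (hmin : IsMinimizer (Node00.avOfRecord F 2 Kt) (Node00.regMSCoPOfRecord F 2 ν Kt k (maxDomT ν.M₁ Z)) (Bj ν.M₁ Z k)
      (avgFamily (Node00.avOfRecord F 2 Kt) (qsstarGIter0 k W)) U₀)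
    {ε : ℝ} (hεpos : 0 < ε)
    (hU : ∀ j ≤ k, PlaqSmallOn (plaqsOf (Node00.topSeq (Node00.suppDomOfRecord F ν Kt (maxDomT ν.M₁ Z)) (maxDomT ν.M₁ Z) j)) (ε * (F.P Kt).eta j ^ 2) U₀)
    (hα3 : (143 * (((((F.P Kt).d + 4 : ℕ) : ℝ)) ^ 2 / 4) ^ 2) * (ε * (F.P Kt).L ^ 2) ≤ 1 / 3)
    (hα2 : 2 * (ε * (F.P Kt).L ^ 2) ≤ 2 * deltaSU (Fin 2) / ((((F.P Kt).d + 4) * (F.P Kt).L : ℕ) : ℝ) ^ 2)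
    (haN : (((((F.P Kt).d + 2) * (F.P Kt).L : ℕ) : ℝ) ^ 2 / 4) * (2 * (ε * (F.P Kt).L ^ 2)) < deltaSU (Fin 2))
    (X : Set (Site (F.P Kt) 0))
    (hBox : ∀ x ∈ X, ∀ w : List (Letter (F.P Kt).d), w.length ≤ (∑ i ∈ Finset.range (k + 1), ((F.P Kt).d * (((F.P Kt).L ^ i - 1) / 2) + 1)) + (3 * ((F.P Kt).d * (((F.P Kt).L - 1) / 2)) + 5) * (F.P Kt).L ^ k + (F.P Kt).L ^ k →
      ∀ μ : Fin (F.P Kt).d, (⟨blockIter k (walkEnd x w), μ⟩ : PBond (F.P Kt) k) ∈ 𝒞)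
    -- the WINDOW of the direct road: its level-`k` box `box (n+3) (lo−2)` and the plaquette window `Wp`, with the two window rows
    (lo hi : Fin (F.P Kt).d → ℤ) (Wp : Finset (Plaq (F.P Kt) 0))
    (hWX : ∀ p ∈ Wp, p.src ∈ X ∧ p.src.shift p.μ ∈ X ∧ p.src.shift p.ν ∈ X ∧ (p.src.shift p.μ).shift p.ν ∈ X ∧ (p.src.shift p.ν).shift p.μ ∈ X)
    (hfeedsX : ∀ (ν' : Fin (F.P Kt).d), ∀ z ∈ box (fun κ => (hi κ - lo κ + 1).toNat + 3) (fun κ => lo κ - 2), ∀ b₀ : PBond (F.P Kt) 0,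
      (b₀ ∈ feeds k (⟨(castSite z : Site (F.P Kt) k), ⟨0, h0⟩⟩ : PBond (F.P Kt) k) ∨
        b₀ ∈ feeds k (⟨((castSite z : Site (F.P Kt) k)).shift ⟨0, h0⟩, ν'⟩ : PBond (F.P Kt) k) ∨
        b₀ ∈ feeds k (⟨((castSite z : Site (F.P Kt) k)).shift ν', ⟨0, h0⟩⟩ : PBond (F.P Kt) k) ∨
        b₀ ∈ feeds k (⟨(castSite z : Site (F.P Kt) k), ν'⟩ : PBond (F.P Kt) k)) → b₀.src ∈ X ∧ b₀.tgt ∈ X)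
    -- any tolerances dominating the window tolerance of `exists_windowGauge_of_plaqSmall`
    {δc δW : ℝ}
    (hδc : (((2 * (∑ i ∈ Finset.range (k + 1), ((F.P Kt).d * (((F.P Kt).L ^ i - 1) / 2) + 1)) + 1 +
              (3 * ((F.P Kt).d * (((F.P Kt).L - 1) / 2)) + 5) * (F.P Kt).L ^ k : ℕ) : ℝ)) ^ 2 / 4 * (ε * (F.P Kt).eta 0 ^ 2) +
            ((3 * ((F.P Kt).d * (((F.P Kt).L - 1) / 2)) + 5 : ℕ) : ℝ) * (6 * ((((((F.P Kt).d + 2) * (F.P Kt).L : ℕ) : ℝ) ^ 2 / 4) * (2 * (ε * (F.P Kt).L ^ 2))) * ∑ i ∈ Finset.range k, ((F.P Kt).L : ℝ) ^ i) +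
            ((3 * ((F.P Kt).d * (((F.P Kt).L - 1) / 2)) + 5 : ℕ) : ℝ) * ρn ≤ δc)
    (hδW : (((2 * (∑ i ∈ Finset.range (k + 1), ((F.P Kt).d * (((F.P Kt).L ^ i - 1) / 2) + 1)) + 1 +
              (3 * ((F.P Kt).d * (((F.P Kt).L - 1) / 2)) + 5) * (F.P Kt).L ^ k : ℕ) : ℝ)) ^ 2 / 4 * (ε * (F.P Kt).eta 0 ^ 2) +
            ((3 * ((F.P Kt).d * (((F.P Kt).L - 1) / 2)) + 5 : ℕ) : ℝ) * (6 * ((((((F.P Kt).d + 2) * (F.P Kt).L : ℕ) : ℝ) ^ 2 / 4) * (2 * (ε * (F.P Kt).L ^ 2))) * ∑ i ∈ Finset.range k, ((F.P Kt).L : ℝ) ^ i) +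
            ((3 * ((F.P Kt).d * (((F.P Kt).L - 1) / 2)) + 5 : ℕ) : ℝ) * ρn ≤ δW) :
    ∃ σ : GaugeTransf (F.P Kt) 0 SU2,
      (∀ j, j ≤ k → ∀ b ∈ bondsOf (Bj ν.M₁ Z k j), toMS σ j b.src = 1 ∧ toMS σ j b.tgt = 1) ∧
      (∀ p ∈ Wp, ‖((gaugeAct σ U₀ ⟨p.src, p.μ⟩ : SU2) : Matrix (Fin 2) (Fin 2) ℂ) - 1‖ ≤ δc ∧ ‖((gaugeAct σ U₀ ⟨p.src.shift p.μ, p.ν⟩ : SU2) : Matrix (Fin 2) (Fin 2) ℂ) - 1‖ ≤ δc ∧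
        ‖((gaugeAct σ U₀ ⟨p.src.shift p.ν, p.μ⟩ : SU2) : Matrix (Fin 2) (Fin 2) ℂ) - 1‖ ≤ δc ∧ ‖((gaugeAct σ U₀ ⟨p.src, p.ν⟩ : SU2) : Matrix (Fin 2) (Fin 2) ℂ) - 1‖ ≤ δc) ∧
      (∀ (ν' : Fin (F.P Kt).d), ∀ z ∈ box (fun κ => (hi κ - lo κ + 1).toNat + 3) (fun κ => lo κ - 2), ∀ b₀ : PBond (F.P Kt) 0,
        (b₀ ∈ feeds k (⟨(castSite z : Site (F.P Kt) k), ⟨0, h0⟩⟩ : PBond (F.P Kt) k) ∨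
          b₀ ∈ feeds k (⟨((castSite z : Site (F.P Kt) k)).shift ⟨0, h0⟩, ν'⟩ : PBond (F.P Kt) k) ∨
          b₀ ∈ feeds k (⟨((castSite z : Site (F.P Kt) k)).shift ν', ⟨0, h0⟩⟩ : PBond (F.P Kt) k) ∨
          b₀ ∈ feeds k (⟨(castSite z : Site (F.P Kt) k), ν'⟩ : PBond (F.P Kt) k)) →
        ‖((gaugeAct σ U₀ b₀ : SU2) : Matrix (Fin 2) (Fin 2) ℂ) - 1‖ ≤ δW) := by
  obtain ⟨σ, hu, -, hb⟩ := exists_windowGauge_of_plaqSmall ν Kt hk0 hk hdiv Z hkc hc hMrad hM₁ hρn W 𝒞 hD hmin hεpos hU hα3 hα2 haN X hBox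
  refine ⟨σ, hu, fun p hp => ?_, fun ν' z hz b₀ hb₀ => ?_⟩
  · obtain ⟨h1, h2, h3, h4, h5⟩ := hWX p hp
    exact ⟨(hb ⟨p.src, p.μ⟩ h1 h2).trans hδc, (hb ⟨p.src.shift p.μ, p.ν⟩ h2 h4).trans hδc, (hb ⟨p.src.shift p.ν, p.μ⟩ h3 h5).trans hδc,
      (hb ⟨p.src, p.ν⟩ h1 h3).trans hδc⟩
  · obtain ⟨hs, ht⟩ := hfeedsX ν' z hz b₀ hb₀
    exact (hb b₀ hs ht).trans hδW

/-- ★★★ **THE FAMILY FORM — LITERALLY THE BINDER `hσW` OF `hWD_of_windowLetters_on` (p658881 :108–122)**, datum `W := ext i V_k`, region `𝒞 := boxBonds (LO i) (HI i)`, `hD := hnV`: per instance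
`i`, from the per-instance numerics, the graded plaquette bound `hU` at every (2.12) minimiser of every guarded normalised datum ([15] Thm 1 (8) ∕ the class reading — the same currency as the
road's P1), the window `X i` (any set of fine sites) with the REGION-BOX ROW (the `k`-shadows within walk-distance `ℓ_k + m′L^k + L^k` of `X i` are bonds of the box `[LO i, HI i]`) and the two window rows,
and tolerances `δc i, δW i` dominating the window tolerance of `exists_windowGauge_of_plaqSmall` — the window gauge letter (σ)_W.  Replaces the restriction producer `B15Prop1WindowGaugeLetterOfGaugeLetterLoc.hσW_of_gaugeLetterN_on`
(scope: simply-connected normalisable `Ω₁(Z_i)`) by a producer with NO hypothesis off the window.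
[cite: Balaban1989LargeFieldII, p.357; Balaban1985Variational, (4) p.278, Thm 1 (8) p.279, (16)–(18) p.280; Balaban1988Convergent, (2.2) p.255, (2.11)–(2.13) pp.256–257, (2.16) p.257] -/
theorem hσW_on_of_plaqSmall {F : T4Family} (ν : Node00.Stage7Numerics) (Kt : ℕ) (h0 : 0 < (F.P Kt).d) {ι : Type}
    (Z Λ : ι → Set (Site (F.P Kt) 0)) (k : ι → ℕ) (hk0 : ∀ i, 0 < k i) (hk : ∀ i, k i ≤ (F.P Kt).m + (F.P Kt).K)
    (eR : ι → ℝ) (lo hi : ι → Fin (F.P Kt).d → ℤ)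
    (ext : ∀ i, GaugeField (F.P Kt) (k i) SU2 → GaugeField (F.P Kt) (k i) SU2)
    (LO HI : ι → Fin (F.P Kt).d → ℤ) (ρn : ι → ℝ) (hρn : ∀ i, 0 ≤ ρn i)
    (hdiv : ∀ i, side (F.P Kt).L ν.M₁ (k i) ∣ (F.P Kt).sitesPerDir 0)
    -- NUMERICS per instance: level guard (no wrapping); radii
    (c : ι → ℕ) (hkc : ∀ i, k i + c i ≤ (F.P Kt).m + (F.P Kt).K) (hc : ∀ i, 4 * (F.P Kt).d + (3 * ((F.P Kt).d * (((F.P Kt).L - 1) / 2)) + 5) + 3 < 2 * (F.P Kt).L ^ c i)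
    (hMrad : (4 * (F.P Kt).d + (3 * ((F.P Kt).d * (((F.P Kt).L - 1) / 2)) + 5)) * (F.P Kt).L ^ 2 + 2 * (F.P Kt).d * (F.P Kt).L + 12 ≤ ν.M₁)
    (hM₁ : (((F.P Kt).d + 4) * (F.P Kt).L + 6) * (F.P Kt).L ^ 2 ≤ ν.M₁)
    (W : ι → Finset (Plaq (F.P Kt) 0))
    -- the graded plaquette bound, FREE scale `ε i`, at every minimiser of every guarded normalised datum ([15] Thm 1 (8) ∕ the class), Prop. 2-small
    {ε : ι → ℝ} (hεpos : ∀ i, 0 < ε i)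
    (hα3 : ∀ i, (143 * (((((F.P Kt).d + 4 : ℕ) : ℝ)) ^ 2 / 4) ^ 2) * (ε i * (F.P Kt).L ^ 2) ≤ 1 / 3)
    (hα2 : ∀ i, 2 * (ε i * (F.P Kt).L ^ 2) ≤ 2 * deltaSU (Fin 2) / ((((F.P Kt).d + 4) * (F.P Kt).L : ℕ) : ℝ) ^ 2)
    (haN : ∀ i, (((((F.P Kt).d + 2) * (F.P Kt).L : ℕ) : ℝ) ^ 2 / 4) * (2 * (ε i * (F.P Kt).L ^ 2)) < deltaSU (Fin 2))
    (hU : ∀ i (Vk : GaugeField (F.P Kt) (k i) SU2), PlaqSmallOn (plaqsInside (pts (k i) (Z i ∩ (Λ i)ᶜ))) (eR i) Vk →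
      (∀ b ∈ (boxBonds (LO i) (HI i) : Set (PBond (F.P Kt) (k i))), dist1 (ext i Vk b) ≤ ρn i) →
      ∀ U₀ : GaugeField (F.P Kt) 0 SU2,
        IsMinimizer (Node00.avOfRecord F 2 Kt) (Node00.regMSCoPOfRecord F 2 ν Kt (k i) (maxDomT ν.M₁ (Z i))) (Bj ν.M₁ (Z i) (k i))
          (avgFamily (Node00.avOfRecord F 2 Kt) (qsstarGIter0 (k i) (ext i Vk))) U₀ →
        ∀ j ≤ k i, PlaqSmallOn (plaqsOf (Node00.topSeq (Node00.suppDomOfRecord F ν Kt (maxDomT ν.M₁ (Z i))) (maxDomT ν.M₁ (Z i)) j)) (ε i * (F.P Kt).eta j ^ 2) U₀)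
    -- the WINDOW per instance (any set of fine sites), with the REGION-BOX ROW and the two window rows
    (X : ι → Set (Site (F.P Kt) 0))
    (hBox : ∀ i, ∀ x ∈ X i, ∀ w : List (Letter (F.P Kt).d),
      w.length ≤ (∑ i' ∈ Finset.range (k i + 1), ((F.P Kt).d * (((F.P Kt).L ^ i' - 1) / 2) + 1)) + (3 * ((F.P Kt).d * (((F.P Kt).L - 1) / 2)) + 5) * (F.P Kt).L ^ k i + (F.P Kt).L ^ k i →
      ∀ μ : Fin (F.P Kt).d, (⟨blockIter (k i) (walkEnd x w), μ⟩ : PBond (F.P Kt) (k i)) ∈ (boxBonds (LO i) (HI i) : Set (PBond (F.P Kt) (k i))))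
    (hWX : ∀ i, ∀ p ∈ W i, p.src ∈ X i ∧ p.src.shift p.μ ∈ X i ∧ p.src.shift p.ν ∈ X i ∧ (p.src.shift p.μ).shift p.ν ∈ X i ∧ (p.src.shift p.ν).shift p.μ ∈ X i)
    (hfeedsX : ∀ i (ν' : Fin (F.P Kt).d), ∀ z ∈ box (fun κ => (hi i κ - lo i κ + 1).toNat + 3) (fun κ => lo i κ - 2), ∀ b₀ : PBond (F.P Kt) 0,
      (b₀ ∈ feeds (k i) (⟨(castSite z : Site (F.P Kt) (k i)), ⟨0, h0⟩⟩ : PBond (F.P Kt) (k i)) ∨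
        b₀ ∈ feeds (k i) (⟨((castSite z : Site (F.P Kt) (k i))).shift ⟨0, h0⟩, ν'⟩ : PBond (F.P Kt) (k i)) ∨
        b₀ ∈ feeds (k i) (⟨((castSite z : Site (F.P Kt) (k i))).shift ν', ⟨0, h0⟩⟩ : PBond (F.P Kt) (k i)) ∨
        b₀ ∈ feeds (k i) (⟨(castSite z : Site (F.P Kt) (k i)), ν'⟩ : PBond (F.P Kt) (k i))) → b₀.src ∈ X i ∧ b₀.tgt ∈ X i)
    -- the instance's tolerances dominate the window tolerance of `exists_windowGauge_of_plaqSmall`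
    {δc δW : ι → ℝ}
    (hδc : ∀ i, (((2 * (∑ i' ∈ Finset.range (k i + 1), ((F.P Kt).d * (((F.P Kt).L ^ i' - 1) / 2) + 1)) + 1 +
              (3 * ((F.P Kt).d * (((F.P Kt).L - 1) / 2)) + 5) * (F.P Kt).L ^ k i : ℕ) : ℝ)) ^ 2 / 4 * (ε i * (F.P Kt).eta 0 ^ 2) +
            ((3 * ((F.P Kt).d * (((F.P Kt).L - 1) / 2)) + 5 : ℕ) : ℝ) * (6 * ((((((F.P Kt).d + 2) * (F.P Kt).L : ℕ) : ℝ) ^ 2 / 4) * (2 * (ε i * (F.P Kt).L ^ 2))) * ∑ i' ∈ Finset.range (k i), ((F.P Kt).L : ℝ) ^ i') +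
            ((3 * ((F.P Kt).d * (((F.P Kt).L - 1) / 2)) + 5 : ℕ) : ℝ) * ρn i ≤ δc i)
    (hδW : ∀ i, (((2 * (∑ i' ∈ Finset.range (k i + 1), ((F.P Kt).d * (((F.P Kt).L ^ i' - 1) / 2) + 1)) + 1 +
              (3 * ((F.P Kt).d * (((F.P Kt).L - 1) / 2)) + 5) * (F.P Kt).L ^ k i : ℕ) : ℝ)) ^ 2 / 4 * (ε i * (F.P Kt).eta 0 ^ 2) +
            ((3 * ((F.P Kt).d * (((F.P Kt).L - 1) / 2)) + 5 : ℕ) : ℝ) * (6 * ((((((F.P Kt).d + 2) * (F.P Kt).L : ℕ) : ℝ) ^ 2 / 4) * (2 * (ε i * (F.P Kt).L ^ 2))) * ∑ i' ∈ Finset.range (k i), ((F.P Kt).L : ℝ) ^ i') +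
            ((3 * ((F.P Kt).d * (((F.P Kt).L - 1) / 2)) + 5 : ℕ) : ℝ) * ρn i ≤ δW i) :
    ∀ i (Vk : GaugeField (F.P Kt) (k i) SU2), PlaqSmallOn (plaqsInside (pts (k i) (Z i ∩ (Λ i)ᶜ))) (eR i) Vk →
      (∀ b ∈ (boxBonds (LO i) (HI i) : Set (PBond (F.P Kt) (k i))), dist1 (ext i Vk b) ≤ ρn i) →
      ∀ U₀ : GaugeField (F.P Kt) 0 SU2,
        IsMinimizer (Node00.avOfRecord F 2 Kt) (Node00.regMSCoPOfRecord F 2 ν Kt (k i) (maxDomT ν.M₁ (Z i))) (Bj ν.M₁ (Z i) (k i))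
          (avgFamily (Node00.avOfRecord F 2 Kt) (qsstarGIter0 (k i) (ext i Vk))) U₀ →
        ∃ σ : GaugeTransf (F.P Kt) 0 SU2,
          (∀ j, j ≤ k i → ∀ b ∈ bondsOf (Bj ν.M₁ (Z i) (k i) j), toMS σ j b.src = 1 ∧ toMS σ j b.tgt = 1) ∧
          (∀ p ∈ W i, ‖((gaugeAct σ U₀ ⟨p.src, p.μ⟩ : SU2) : Matrix (Fin 2) (Fin 2) ℂ) - 1‖ ≤ δc i ∧ ‖((gaugeAct σ U₀ ⟨p.src.shift p.μ, p.ν⟩ : SU2) : Matrix (Fin 2) (Fin 2) ℂ) - 1‖ ≤ δc i ∧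
            ‖((gaugeAct σ U₀ ⟨p.src.shift p.ν, p.μ⟩ : SU2) : Matrix (Fin 2) (Fin 2) ℂ) - 1‖ ≤ δc i ∧ ‖((gaugeAct σ U₀ ⟨p.src, p.ν⟩ : SU2) : Matrix (Fin 2) (Fin 2) ℂ) - 1‖ ≤ δc i) ∧
          (∀ (ν' : Fin (F.P Kt).d), ∀ z ∈ box (fun κ => (hi i κ - lo i κ + 1).toNat + 3) (fun κ => lo i κ - 2), ∀ b₀ : PBond (F.P Kt) 0,
            (b₀ ∈ feeds (k i) (⟨(castSite z : Site (F.P Kt) (k i)), ⟨0, h0⟩⟩ : PBond (F.P Kt) (k i)) ∨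
              b₀ ∈ feeds (k i) (⟨((castSite z : Site (F.P Kt) (k i))).shift ⟨0, h0⟩, ν'⟩ : PBond (F.P Kt) (k i)) ∨
              b₀ ∈ feeds (k i) (⟨((castSite z : Site (F.P Kt) (k i))).shift ν', ⟨0, h0⟩⟩ : PBond (F.P Kt) (k i)) ∨
              b₀ ∈ feeds (k i) (⟨(castSite z : Site (F.P Kt) (k i)), ν'⟩ : PBond (F.P Kt) (k i))) →
            ‖((gaugeAct σ U₀ b₀ : SU2) : Matrix (Fin 2) (Fin 2) ℂ) - 1‖ ≤ δW i) := by
  intro i Vk hV hnV U₀ hmin0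
  exact hσW_local_of_plaqSmall ν Kt h0 (hk0 i) (hk i) (hdiv i) (Z i) (hkc i) (hc i) hMrad hM₁ (hρn i) (ext i Vk) (boxBonds (LO i) (HI i)) hnV hmin0 (hεpos i)
    (hU i Vk hV hnV U₀ hmin0) (hα3 i) (hα2 i) (haN i) (X i) (hBox i) (lo i) (hi i) (W i) (hWX i) (hfeedsX i) (hδc i) (hδW i)

/-- ★★★ **THE FAMILY FORM — LITERALLY THE BINDER `hσW` OF `hWD_of_windowLetters_on` (p658881 :108–122)**, datum `W := ext i V_k`, region `𝒞 := boxBonds (LO i) (HI i)`, `hD := hnV`: per instance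
`i`, from the per-instance numerics, the graded plaquette bound `hU` at every (2.12) minimiser of every guarded normalised datum ([15] Thm 1 (8) ∕ the class reading — the same currency as the
road's P1), the window `X i` (any set of fine sites) with the REGION-BOX ROW (the `k`-shadows within walk-distance `ℓ_k + m′L^k + L^k` of `X i` are bonds of the box `[LO i, HI i]`) and the two window rows,
and tolerances `δc i, δW i` dominating the window tolerance of `exists_windowGauge_of_plaqSmall` — the window gauge letter (σ)_W.  Replaces the restriction producer `B15Prop1WindowGaugeLetterOfGaugeLetterLoc.hσW_of_gaugeLetterN_on`
(scope: simply-connected normalisable `Ω₁(Z_i)`) by a producer with NO hypothesis off the window.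
[cite: Balaban1989LargeFieldII, p.357; Balaban1985Variational, (4) p.278, Thm 1 (8) p.279, (16)–(18) p.280; Balaban1988Convergent, (2.2) p.255, (2.11)–(2.13) pp.256–257, (2.16) p.257] -/
theorem hσW_on_of_class {F : T4Family} (ν : Node00.Stage7Numerics) (Kt : ℕ) (h0 : 0 < (F.P Kt).d) {ι : Type}
    (Z Λ : ι → Set (Site (F.P Kt) 0)) (k : ι → ℕ) (hk0 : ∀ i, 0 < k i) (hk : ∀ i, k i ≤ (F.P Kt).m + (F.P Kt).K)
    (eR : ι → ℝ) (lo hi : ι → Fin (F.P Kt).d → ℤ)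
    (ext : ∀ i, GaugeField (F.P Kt) (k i) SU2 → GaugeField (F.P Kt) (k i) SU2)
    (LO HI : ι → Fin (F.P Kt).d → ℤ) (ρn : ι → ℝ) (hρn : ∀ i, 0 ≤ ρn i)
    (hdiv : ∀ i, side (F.P Kt).L ν.M₁ (k i) ∣ (F.P Kt).sitesPerDir 0)
    -- NUMERICS per instance: level guard (no wrapping); radii
    (c : ι → ℕ) (hkc : ∀ i, k i + c i ≤ (F.P Kt).m + (F.P Kt).K) (hc : ∀ i, 4 * (F.P Kt).d + (3 * ((F.P Kt).d * (((F.P Kt).L - 1) / 2)) + 5) + 3 < 2 * (F.P Kt).L ^ c i)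
    (hMrad : (4 * (F.P Kt).d + (3 * ((F.P Kt).d * (((F.P Kt).L - 1) / 2)) + 5)) * (F.P Kt).L ^ 2 + 2 * (F.P Kt).d * (F.P Kt).L + 12 ≤ ν.M₁)
    (hM₁ : (((F.P Kt).d + 4) * (F.P Kt).L + 6) * (F.P Kt).L ^ 2 ≤ ν.M₁)
    (W : ι → Finset (Plaq (F.P Kt) 0))
    -- the class threshold `εreg`: positive and small
    (hεpos : 0 < ν.εreg)
    (hα3 : (143 * (((((F.P Kt).d + 4 : ℕ) : ℝ)) ^ 2 / 4) ^ 2) * (ν.εreg * (F.P Kt).L ^ 2) ≤ 1 / 3)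
    (hα2 : 2 * (ν.εreg * (F.P Kt).L ^ 2) ≤ 2 * deltaSU (Fin 2) / ((((F.P Kt).d + 4) * (F.P Kt).L : ℕ) : ℝ) ^ 2)
    (haN : (((((F.P Kt).d + 2) * (F.P Kt).L : ℕ) : ℝ) ^ 2 / 4) * (2 * (ν.εreg * (F.P Kt).L ^ 2)) < deltaSU (Fin 2))
    -- the WINDOW per instance (any set of fine sites), with the REGION-BOX ROW and the two window rows
    (X : ι → Set (Site (F.P Kt) 0))
    (hBox : ∀ i, ∀ x ∈ X i, ∀ w : List (Letter (F.P Kt).d),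
      w.length ≤ (∑ i' ∈ Finset.range (k i + 1), ((F.P Kt).d * (((F.P Kt).L ^ i' - 1) / 2) + 1)) + (3 * ((F.P Kt).d * (((F.P Kt).L - 1) / 2)) + 5) * (F.P Kt).L ^ k i + (F.P Kt).L ^ k i →
      ∀ μ : Fin (F.P Kt).d, (⟨blockIter (k i) (walkEnd x w), μ⟩ : PBond (F.P Kt) (k i)) ∈ (boxBonds (LO i) (HI i) : Set (PBond (F.P Kt) (k i))))
    (hWX : ∀ i, ∀ p ∈ W i, p.src ∈ X i ∧ p.src.shift p.μ ∈ X i ∧ p.src.shift p.ν ∈ X i ∧ (p.src.shift p.μ).shift p.ν ∈ X i ∧ (p.src.shift p.ν).shift p.μ ∈ X i)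
    (hfeedsX : ∀ i (ν' : Fin (F.P Kt).d), ∀ z ∈ box (fun κ => (hi i κ - lo i κ + 1).toNat + 3) (fun κ => lo i κ - 2), ∀ b₀ : PBond (F.P Kt) 0,
      (b₀ ∈ feeds (k i) (⟨(castSite z : Site (F.P Kt) (k i)), ⟨0, h0⟩⟩ : PBond (F.P Kt) (k i)) ∨
        b₀ ∈ feeds (k i) (⟨((castSite z : Site (F.P Kt) (k i))).shift ⟨0, h0⟩, ν'⟩ : PBond (F.P Kt) (k i)) ∨
        b₀ ∈ feeds (k i) (⟨((castSite z : Site (F.P Kt) (k i))).shift ν', ⟨0, h0⟩⟩ : PBond (F.P Kt) (k i)) ∨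
        b₀ ∈ feeds (k i) (⟨(castSite z : Site (F.P Kt) (k i)), ν'⟩ : PBond (F.P Kt) (k i))) → b₀.src ∈ X i ∧ b₀.tgt ∈ X i)
    -- the instance's tolerances dominate the window tolerance at `ε := εreg`
    {δc δW : ι → ℝ}
    (hδc : ∀ i, (((2 * (∑ i' ∈ Finset.range (k i + 1), ((F.P Kt).d * (((F.P Kt).L ^ i' - 1) / 2) + 1)) + 1 +
              (3 * ((F.P Kt).d * (((F.P Kt).L - 1) / 2)) + 5) * (F.P Kt).L ^ k i : ℕ) : ℝ)) ^ 2 / 4 * (ν.εreg * (F.P Kt).eta 0 ^ 2) +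
            ((3 * ((F.P Kt).d * (((F.P Kt).L - 1) / 2)) + 5 : ℕ) : ℝ) * (6 * ((((((F.P Kt).d + 2) * (F.P Kt).L : ℕ) : ℝ) ^ 2 / 4) * (2 * (ν.εreg * (F.P Kt).L ^ 2))) * ∑ i' ∈ Finset.range (k i), ((F.P Kt).L : ℝ) ^ i') +
            ((3 * ((F.P Kt).d * (((F.P Kt).L - 1) / 2)) + 5 : ℕ) : ℝ) * ρn i ≤ δc i)
    (hδW : ∀ i, (((2 * (∑ i' ∈ Finset.range (k i + 1), ((F.P Kt).d * (((F.P Kt).L ^ i' - 1) / 2) + 1)) + 1 +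
              (3 * ((F.P Kt).d * (((F.P Kt).L - 1) / 2)) + 5) * (F.P Kt).L ^ k i : ℕ) : ℝ)) ^ 2 / 4 * (ν.εreg * (F.P Kt).eta 0 ^ 2) +
            ((3 * ((F.P Kt).d * (((F.P Kt).L - 1) / 2)) + 5 : ℕ) : ℝ) * (6 * ((((((F.P Kt).d + 2) * (F.P Kt).L : ℕ) : ℝ) ^ 2 / 4) * (2 * (ν.εreg * (F.P Kt).L ^ 2))) * ∑ i' ∈ Finset.range (k i), ((F.P Kt).L : ℝ) ^ i') +
            ((3 * ((F.P Kt).d * (((F.P Kt).L - 1) / 2)) + 5 : ℕ) : ℝ) * ρn i ≤ δW i) :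
    ∀ i (Vk : GaugeField (F.P Kt) (k i) SU2), PlaqSmallOn (plaqsInside (pts (k i) (Z i ∩ (Λ i)ᶜ))) (eR i) Vk →
      (∀ b ∈ (boxBonds (LO i) (HI i) : Set (PBond (F.P Kt) (k i))), dist1 (ext i Vk b) ≤ ρn i) →
      ∀ U₀ : GaugeField (F.P Kt) 0 SU2,
        IsMinimizer (Node00.avOfRecord F 2 Kt) (Node00.regMSCoPOfRecord F 2 ν Kt (k i) (maxDomT ν.M₁ (Z i))) (Bj ν.M₁ (Z i) (k i))
          (avgFamily (Node00.avOfRecord F 2 Kt) (qsstarGIter0 (k i) (ext i Vk))) U₀ →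
        ∃ σ : GaugeTransf (F.P Kt) 0 SU2,
          (∀ j, j ≤ k i → ∀ b ∈ bondsOf (Bj ν.M₁ (Z i) (k i) j), toMS σ j b.src = 1 ∧ toMS σ j b.tgt = 1) ∧
          (∀ p ∈ W i, ‖((gaugeAct σ U₀ ⟨p.src, p.μ⟩ : SU2) : Matrix (Fin 2) (Fin 2) ℂ) - 1‖ ≤ δc i ∧ ‖((gaugeAct σ U₀ ⟨p.src.shift p.μ, p.ν⟩ : SU2) : Matrix (Fin 2) (Fin 2) ℂ) - 1‖ ≤ δc i ∧
            ‖((gaugeAct σ U₀ ⟨p.src.shift p.ν, p.μ⟩ : SU2) : Matrix (Fin 2) (Fin 2) ℂ) - 1‖ ≤ δc i ∧ ‖((gaugeAct σ U₀ ⟨p.src, p.ν⟩ : SU2) : Matrix (Fin 2) (Fin 2) ℂ) - 1‖ ≤ δc i) ∧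
          (∀ (ν' : Fin (F.P Kt).d), ∀ z ∈ box (fun κ => (hi i κ - lo i κ + 1).toNat + 3) (fun κ => lo i κ - 2), ∀ b₀ : PBond (F.P Kt) 0,
            (b₀ ∈ feeds (k i) (⟨(castSite z : Site (F.P Kt) (k i)), ⟨0, h0⟩⟩ : PBond (F.P Kt) (k i)) ∨
              b₀ ∈ feeds (k i) (⟨((castSite z : Site (F.P Kt) (k i))).shift ⟨0, h0⟩, ν'⟩ : PBond (F.P Kt) (k i)) ∨
              b₀ ∈ feeds (k i) (⟨((castSite z : Site (F.P Kt) (k i))).shift ν', ⟨0, h0⟩⟩ : PBond (F.P Kt) (k i)) ∨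
              b₀ ∈ feeds (k i) (⟨(castSite z : Site (F.P Kt) (k i)), ν'⟩ : PBond (F.P Kt) (k i))) →
            ‖((gaugeAct σ U₀ b₀ : SU2) : Matrix (Fin 2) (Fin 2) ℂ) - 1‖ ≤ δW i) := by
  intro i Vk _ hnV U₀ hmin0
  exact hσW_local_of_plaqSmall ν Kt h0 (hk0 i) (hk i) (hdiv i) (Z i) (hkc i) (hc i) hMrad hM₁ (hρn i) (ext i Vk) (boxBonds (LO i) (HI i)) hnV hmin0 hεpos
    (fun j hj => ((Node00.mem_regMSCoPOfRecord_iff F 2 ν Kt (k i) (maxDomT ν.M₁ (Z i)) U₀).1 hmin0.1).1 j hj) hα3 hα2 haN (X i) (hBox i) (lo i) (hi i) (W i) (hWX i) (hfeedsX i)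
    (hδc i) (hδW i)

end Summit.QuantumFields.YangMills.BalabanUVNodes.N12WindowGaugeLetterLocalSocket

end
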